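import Summits.KontsevichZagierPeriods.KontsevichZagierPeriods.Theorems.RootDecompQuadraticDescentPair18ReductionP3

/-! # `RootDecompQuadraticDescentPair18ReductionP4` — part 4/7 of the mechanical ≤400-line split of `Pair18Reduction_v5_landing.lean` (sha256 0a10c70876ba8bf2…)
Source: decomp-kz lens-6 g8 `Pair18Reduction.lean` v5 (HOME/decomp-kz-lens-6/g8/, sha256 9036e907…; critic g3 CLEARED 12:08:58Z/13:14:52Z): census pair #18 reduced to strips — `pair18_iff_strips : KZ.of A18.rep − 2 • KZ.of B18.rep ∈ KZ.relations ↔ [U1] − [U2r] + [SL] − 2•[K12c] + 2•[Kh] ∈ KZ.relations` (namespace …RootDecompQuadraticDescent.Pair18); `#print axioms` pins removed for landing.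
Split by census-1 g9 `gen/splitlean.py`: scopes re-opened with their `open`/`variable`/`set_option` context; mathematics and declaration order unchanged. -/

noncomputable section
open MeasureTheory Set MvPolynomial
namespace Summit.KontsevichZagierPeriods.RootDecompQuadraticDescent.Pair18
open Literature.NumberTheory.Transcendental
open Literature.NumberTheory.Transcendental.KZ
open Literature.ModelTheory.ExponentialFields (IsSemialgebraic continuous_aeval_real)
open Summit.KontsevichZagierPeriods.RootDecompQuadraticDescent.DarkPairs (rel_reflect_rep rel_double
  update_one_apply_zero one_div_eq_mul_one_div)
/-- Auxiliary step `last_one_eq` (§1): last one eq. [bookkeeping] -/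
private theorem last_one_eq : (Fin.last 1 : Fin 2) = 1 := rfl

/-- Auxiliary step `rel_trans` (§2): rel trans. [bookkeeping] -/
private theorem rel_trans {a b c : KZ.FormalRep} (h₁ : a - b ∈ KZ.relations) (h₂ : b - c ∈ KZ.relations) :
    a - c ∈ KZ.relations := by
  have h := add_mem h₁ h₂
  rwa [sub_add_sub_cancel] at h

/-- Auxiliary step `rel_symm` (§2): rel symm. [bookkeeping] -/
private theorem rel_symm {a b : KZ.FormalRep} (h : a - b ∈ KZ.relations) : b - a ∈ KZ.relations := by
  have h' := neg_mem h
  rwa [neg_sub] at h'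

/-- Linearity in the integrand (rule 1b). -/
private theorem rel_lin (T S U : RFun 2) (h : ∀ x ∈ cube 2, T.fn x = S.fn x + U.fn x) :
    KZ.of T.rep - KZ.of S.rep - KZ.of U.rep ∈ KZ.relations :=
  KZ.cubicalLinGens_subset_relations (KZ.mem_cubicalLinGens T.isTameCube_rep S.isTameCube_rep
    U.isTameCube_rep fun x hx => by simpa using h x hx)

/-- Auxiliary step `init2_zero` (§1): init2 zero. [bookkeeping] -/
@[simp] private theorem init2_zero (z : Fin 2 → ℝ) : Fin.init z 0 = z 0 := rfl

/-- **(box → band)** the affine fibre substitution `s = 1 + E(t)·σ` from the square onto the shifted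
band `{1 ≤ s ≤ 1 + E(t)}`, for an edge `E` positive and differentiable on the OPEN base (it may vanish
at `t = 0, 1`): rule 2 over the open base (`KZ.of_sub_of_mem_relations_of_affine`) between two null
moves. -/
private theorem box_to_band (E : Edge) (hEpos : ∀ t ∈ Ioo (0 : ℝ) 1, 0 < E.f t)
    (hEd : DifferentiableOn ℝ E.f (Ioo 0 1)) (P : RFun 2) (R : KZ.IntegralRep 2)
    (hR : R.domain = sbDom oneE E.onePlus)
    (hint : ∀ z ∈ cube 2, 0 < z 0 → z 0 < 1 →
      P.fn z = R.integrand (Fin.snoc (Fin.init z) (1 + E.f (z 0) * z 1)) * E.f (z 0)) :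
    KZ.of P.rep - KZ.of R ∈ KZ.relations := by
  have hP : P.rep.domain = sbDom zeroE oneE := by rw [RFun.rep_domain, cube_eq_sbDom]
  have h1 := rel_open P.rep zeroE oneE hP
  have h3 := rel_open R oneE E.onePlus hR
  have h2 : KZ.of (OB P.rep zeroE oneE hP) - KZ.of (OB R oneE E.onePlus hR) ∈ KZ.relations := by
    refine of_sub_of_mem_relations_of_affine isOpen_Gopen (α := fun _ => (1 : ℝ))
      (β := fun y => E.f (y 0)) (a := fun y => zeroE.f (y 0)) (b := fun y => oneE.f (y 0))
      (a' := fun y => oneE.f (y 0)) (b' := fun y => E.onePlus.f (y 0)) ?_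
      (E.sa.mono Gopen_subset isSemialgebraic_Gopen) (differentiableOn_const _) ?_
      (fun y hy => hEpos _ ⟨hy.1, hy.2⟩) _ _ rfl rfl (fun y _ => by simp) (fun y _ => by simp)
      fun z hz => ?_
    · simpa using isSemialgebraicFunOn_ratCast isSemialgebraic_Gopen 1
    · exact hEd.comp (fun y _ => (differentiableAt_apply (𝕜 := ℝ) 0 y).differentiableWithinAt)
        fun y hy => ⟨hy.1, hy.2⟩
    · have hz' : z ∈ obDom zeroE oneE := hz
      rw [mem_obDom] at hz'
      have hzc : z ∈ cube 2 := by
        rw [cube_eq_sbDom]; exact obDom_subset zeroE oneE hz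
      rw [OB_integrand, OB_integrand, RFun.rep_integrand, last_one_eq]
      simpa only [init2_zero] using hint z hzc hz'.1.1 hz'.1.2
  exact rel_trans (rel_trans h1 h2) (rel_symm h3)

/-- Auxiliary step `abs_aeval_one_le` (§5): abs aeval one le. [bookkeeping] -/
private theorem abs_aeval_one_le (z : Fin 2 → ℝ) : |aeval z (1 : MvPolynomial (Fin 2) ℚ)| ≤ 1 := by simp

/-- The line `{t = q}` in `ℝ²` is null. -/
private theorem volume_vline (q : ℝ) : volume {z : Fin 2 → ℝ | z 0 = q} = 0 :=
  measure_mono_null (fun _ hz => hz)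
    (KZ.volume_setOf_init_mem_eq_zero (n := 1) (KZ.volume_setOf_last_eq_zero (n := 0) q))

/-- Auxiliary step `ivl_subset`: ivl subset. [bookkeeping] -/
private theorem ivl_subset {lo hi : ℚ} (hlo : 0 ≤ lo) (hhi : hi ≤ 1) : ivl lo hi ⊆ ivl 0 1 := fun y hy => by
  rw [mem_ivl] at hy ⊢
  have h1 : ((0 : ℚ) : ℝ) ≤ lo := by exact_mod_cast hlo
  have h2 : ((hi : ℚ) : ℝ) ≤ ((1 : ℚ) : ℝ) := by exact_mod_cast hhi
  exact ⟨h1.trans hy.1, hy.2.trans h2⟩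

/-- Auxiliary step `snoc2_zero` (§1): snoc2 zero. [bookkeeping] -/
@[simp] private theorem snoc2_zero (x : Fin 1 → ℝ) (t : ℝ) : (Fin.snoc x t : Fin 2 → ℝ) 0 = x 0 := rfl

/-- Auxiliary step `snoc2_one` (§1): snoc2 one. [bookkeeping] -/
@[simp] private theorem snoc2_one (x : Fin 1 → ℝ) (t : ℝ) : (Fin.snoc x t : Fin 2 → ℝ) 1 = t := rfl

/-- (m6) affine fibre map `s = 1 + σ/(1+u)`: `Pa ≡ R2`. -/
theorem m6 (c : ℚ) (hc : -1 ≤ c ∧ c ≤ 1) : KZ.of (Pa c hc).rep - KZ.of (R2 c hc) ∈ KZ.relations := by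
  refine box_to_band rE (fun t ht => by have := ht.1; simp only [rE_f]; positivity)
    (fun t ht => ?_) (Pa c hc) (R2 c hc) rfl fun z hz h0 h0' => ?_
  · have h1 : (1 : ℝ) + t ≠ 0 := by linarith [ht.1]
    apply DifferentiableAt.differentiableWithinAt
    show DifferentiableAt ℝ (fun t : ℝ => 1 / (1 + t)) t
    fun_prop (disch := assumption)
  · have hG := QG_pos hc hz
    have h1u := (hz 1).2
    simp only [QG, map_add, map_mul, map_pow, map_one, aeval_C, aeval_X, eq_ratCast] at hG
    simp only [RFun.fn, Pa, R2, QP, Q2, BRq_integrand, map_add, map_mul, map_sub, map_pow, map_one,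
      aeval_C, aeval_X, eq_ratCast, snoc2_zero, snoc2_one, init2_zero, rE_f, add_sub_cancel_left]
    have hu : (1 : ℝ) + z 0 ≠ 0 := by linarith
    have hD : ((1 : ℝ) + z 0) ^ 2 + (c : ℝ) * z 0 * z 1 ≠ 0 := hG.ne'
    have hD' : (1 : ℝ) + z 0 + (c : ℝ) * z 0 * (1 / (1 + z 0) * z 1) ≠ 0 := by
      rw [show (1 : ℝ) + z 0 + (c : ℝ) * z 0 * (1 / (1 + z 0) * z 1) =
        ((1 + z 0) ^ 2 + (c : ℝ) * z 0 * z 1) / (1 + z 0) by field_simp; try ring]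
      exact div_ne_zero hD hu
    field_simp
    try ring

/-- (m7) merge: `G(c) ≡ Pa(c) + Pb(c)` (rule 1b). -/
theorem m7 (c : ℚ) (hc : -1 ≤ c ∧ c ≤ 1) :
    KZ.of (Gc c hc).rep - KZ.of (Pa c hc).rep - KZ.of (Pb c hc).rep ∈ KZ.relations := by
  refine rel_lin (Gc c hc) (Pa c hc) (Pb c hc) fun x hx => ?_
  have hG := (QG_pos hc hx).ne'
  have h0 := (hx 0).1
  simp only [QG, map_add, map_mul, map_pow, map_one, aeval_C, aeval_X, eq_ratCast] at hG
  simp only [RFun.fn, Gc, Pa, Pb, QG, QP, map_add, map_mul, map_pow, map_one, aeval_C, aeval_X,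
    eq_ratCast]
  have hu : (1 : ℝ) + x 0 ≠ 0 := by linarith
  field_simp
  try ring

/-- **The c-trick**: `TΔ(c) ≡ G(c)` in `KZ.relations`. -/
theorem tΔ_G (c : ℚ) (hc : -1 ≤ c ∧ c ≤ 1) : KZ.of (TΔ c hc) - KZ.of (Gc c hc).rep ∈ KZ.relations := by
  have h := sub_mem (sub_mem (sub_mem (sub_mem (sub_mem (add_mem (m1 c hc) (m2 c hc)) (m4 c hc))
    (m3 c hc)) (m6 c hc)) (m5 c hc)) (m7 c hc)
  convert h using 1
  abel

/-! ## §8 The A-side: `A18 ≡ [Δ, 1/(2 + wv)] + [Δ, 1/(2 − wv)]` by dissecting the square along its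
two diagonals (`GoldenPair10.lean` §8 with `κ = 2`)

`Q_A18 = 2 − x + y + x² − y² = 2 + (x − y)(x + y − 1)`.  In the coordinates `p = x − y`, `q = x + y − 1`
the square is the diamond `|p| + |q| ≤ 1`; its four quadrants are the triangles below / above both
diagonals (`pq ≤ 0`) and left / right of both (`pq ≥ 0`), each mapped linearly (`|det| = 2`) onto
`Δ`, where the integrand becomes `1/(2(2 ∓ wv))`. -/

/-! ### min / max edges and base cuts of general bands -/

/-- Auxiliary step `sa_min` (§8): sa min. [bookkeeping] -/
private theorem sa_min (E F : Edge) :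
    IsSemialgebraicFunOn ℚ (ivl 0 1) (fun y => min (E.f (y 0)) (F.f (y 0))) := by
  have h := IsSemialgebraicFunOn.mul_holds (isSemialgebraicFunOn_ratCast (isSemialgebraic_ivl 0 1) (1 / 2))
    (IsSemialgebraicFunOn.sub_holds (IsSemialgebraicFunOn.add_holds E.sa F.sa)
      (IsSemialgebraicFunOn.sub_holds E.sa F.sa).abs)
  refine h.congr fun y _ => ?_
  try simp only [Pi.mul_apply, Pi.sub_apply, Pi.add_apply]
  rcases le_total (E.f (y 0)) (F.f (y 0)) with hle | hle
  · rw [min_eq_left hle, abs_of_nonpos (by linarith)]; push_cast; ring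
  · rw [min_eq_right hle, abs_of_nonneg (by linarith)]; push_cast; ring

/-- Auxiliary step `sa_max` (§8): sa max. [bookkeeping] -/
private theorem sa_max (E F : Edge) :
    IsSemialgebraicFunOn ℚ (ivl 0 1) (fun y => max (E.f (y 0)) (F.f (y 0))) := by
  have h := IsSemialgebraicFunOn.mul_holds (isSemialgebraicFunOn_ratCast (isSemialgebraic_ivl 0 1) (1 / 2))
    (IsSemialgebraicFunOn.add_holds (IsSemialgebraicFunOn.add_holds E.sa F.sa)
      (IsSemialgebraicFunOn.sub_holds E.sa F.sa).abs)
  refine h.congr fun y _ => ?_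
  try simp only [Pi.mul_apply, Pi.sub_apply, Pi.add_apply]
  rcases le_total (E.f (y 0)) (F.f (y 0)) with hle | hle
  · rw [max_eq_right hle, abs_of_nonpos (by linarith)]; push_cast; ring
  · rw [max_eq_left hle, abs_of_nonneg (by linarith)]; push_cast; ring

/-- Pointwise `min` / `max` of two edges. -/
def minE (E F : Edge) : Edge :=
  ⟨fun t => min (E.f t) (F.f t), sa_min E F, fun t ht => le_min (E.nonneg t ht) (F.nonneg t ht), by
    have h := ((E.cont.add F.cont).sub (continuous_abs.comp_continuousOn (E.cont.sub F.cont))).div_const 2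
    refine h.congr fun t _ => ?_
    simp only [Pi.add_apply, Pi.sub_apply, Function.comp_apply]
    rcases le_total (E.f t) (F.f t) with hle | hle
    · rw [min_eq_left hle, abs_of_nonpos (by linarith)]; ring
    · rw [min_eq_right hle, abs_of_nonneg (by linarith)]; ring⟩
/-- Auxiliary definition `maxE` (§8): max E. [bookkeeping] -/
def maxE (E F : Edge) : Edge :=
  ⟨fun t => max (E.f t) (F.f t), sa_max E F, fun t ht => (E.nonneg t ht).trans (le_max_left _ _), by
    have h := ((E.cont.add F.cont).add (continuous_abs.comp_continuousOn (E.cont.sub F.cont))).div_const 2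
    refine h.congr fun t _ => ?_
    simp only [Pi.add_apply, Pi.sub_apply, Function.comp_apply]
    rcases le_total (E.f t) (F.f t) with hle | hle
    · rw [max_eq_right hle, abs_of_nonpos (by linarith)]; ring
    · rw [max_eq_left hle, abs_of_nonneg (by linarith)]; ring⟩
/-- Auxiliary step `minE_f` (§8): min E f. [bookkeeping] -/
@[simp] theorem minE_f (E F : Edge) (t : ℝ) : (minE E F).f t = min (E.f t) (F.f t) := rfl
/-- Auxiliary step `maxE_f` (§8): max E f. [bookkeeping] -/
@[simp] theorem maxE_f (E F : Edge) (t : ℝ) : (maxE E F).f t = max (E.f t) (F.f t) := rfl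

/-- The broken edges `min(x, 1 − x)` and `max(x, 1 − x)` (the two diagonals of the square, folded). -/
def mnE : Edge := minE idE omE
/-- Auxiliary definition `mxE` (§8): mx E. [bookkeeping] -/
def mxE : Edge := maxE idE omE
/-- Auxiliary step `mnE_f` (§8): mn E f. [bookkeeping] -/
@[simp] theorem mnE_f (t : ℝ) : mnE.f t = min t (1 - t) := rfl
/-- Auxiliary step `mxE_f` (§8): mx E f. [bookkeeping] -/
@[simp] theorem mxE_f (t : ℝ) : mxE.f t = max t (1 - t) := rfl

/-- The part of a general band over the base sub-interval `[lo, hi] ⊆ [0, 1]`. -/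
def gband (lo hi : ℚ) (L U : Edge) : Set (Fin 2 → ℝ) :=
  KZlog.band (ivl lo hi) (fun y => L.f (y 0)) (fun y => U.f (y 0))

/-- Auxiliary step `mem_gband` (§8): mem gband. [bookkeeping] -/
theorem mem_gband {lo hi : ℚ} {L U : Edge} {z : Fin 2 → ℝ} :
    z ∈ gband lo hi L U ↔ ((lo : ℝ) ≤ z 0 ∧ z 0 ≤ hi) ∧ L.f (z 0) ≤ z 1 ∧ z 1 ≤ U.f (z 0) := by
  show (Fin.init z ∈ ivl lo hi ∧ L.f (Fin.init z 0) ≤ z (Fin.last 1) ∧ z (Fin.last 1) ≤ U.f (Fin.init z 0)) ↔ _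
  rw [mem_ivl]
  rfl

/-- Auxiliary step `isSemialgebraic_gband` (§8): is Semialgebraic gband. [bookkeeping] -/
theorem isSemialgebraic_gband (lo hi : ℚ) (hlo : 0 ≤ lo) (hhi : hi ≤ 1) (L U : Edge) :
    IsSemialgebraic ℚ (gband lo hi L U) :=
  KZlog.isSemialgebraic_band (L.sa.mono (ivl_subset hlo hhi) (isSemialgebraic_ivl lo hi))
    (U.sa.mono (ivl_subset hlo hhi) (isSemialgebraic_ivl lo hi))

/-- Auxiliary step `gband_subset` (§8): gband subset. [bookkeeping] -/
theorem gband_subset (lo hi : ℚ) (hlo : 0 ≤ lo) (hhi : hi ≤ 1) (L U : Edge) :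
    gband lo hi L U ⊆ sbDom L U := fun z hz => by
  rw [mem_gband] at hz
  rw [mem_sbDom]
  have h1 : ((0 : ℚ) : ℝ) ≤ lo := by exact_mod_cast hlo
  have h2 : ((hi : ℚ) : ℝ) ≤ ((1 : ℚ) : ℝ) := by exact_mod_cast hhi
  push_cast at h1 h2
  exact ⟨⟨h1.trans hz.1.1, hz.1.2.trans h2⟩, hz.2.1, hz.2.2⟩

/-- The piece of a band representation over the base sub-interval `[lo, hi]`. -/
def GB (R : KZ.IntegralRep 2) (L U : Edge) (hR : R.domain = sbDom L U) (lo hi : ℚ)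
    (hlo : 0 ≤ lo) (hhi : hi ≤ 1) : KZ.IntegralRep 2 :=
  R.restrict (gband lo hi L U) (isSemialgebraic_gband lo hi hlo hhi L U)
    (by rw [hR]; exact gband_subset lo hi hlo hhi L U)

/-- Auxiliary step `GB_domain` (§8): GB domain. [bookkeeping] -/
@[simp] theorem GB_domain (R : KZ.IntegralRep 2) (L U : Edge) (hR lo hi hlo hhi) :
    (GB R L U hR lo hi hlo hhi).domain = gband lo hi L U := rfl
/-- Auxiliary step `GB_integrand` (§8): GB integrand. [bookkeeping] -/
@[simp] theorem GB_integrand (R : KZ.IntegralRep 2) (L U : Edge) (hR lo hi hlo hhi) :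
    (GB R L U hR lo hi hlo hhi).integrand = R.integrand := rfl

/-- **(base cut, general band)** additivity along the vertical line `t = q` (rule 1a). -/
theorem gcut (R : KZ.IntegralRep 2) (L U : Edge) (hR : R.domain = sbDom L U) (q : ℚ)
    (hq0 : 0 ≤ q) (hq1 : q ≤ 1) :
    KZ.of R - KZ.of (GB R L U hR 0 q le_rfl hq1) - KZ.of (GB R L U hR q 1 hq0 le_rfl) ∈ KZ.relations := by
  refine KZ.domainAddRel_subset_relations ⟨2, R, GB R L U hR 0 q le_rfl hq1, GB R L U hR q 1 hq0 le_rfl,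
    ?_, ?_, fun z _ => rfl, fun z _ => rfl, rfl⟩
  · rw [hR]
    ext z
    simp only [GB_domain, mem_union, mem_sbDom, mem_gband, Rat.cast_zero, Rat.cast_one]
    constructor
    · rintro ⟨⟨h0, h0'⟩, h1, h2⟩
      rcases le_total (z 0) (q : ℝ) with h | h
      · exact Or.inl ⟨⟨h0, h⟩, h1, h2⟩
      · exact Or.inr ⟨⟨h, h0'⟩, h1, h2⟩
    · have hq0' : (0 : ℝ) ≤ q := by exact_mod_cast hq0
      have hq1' : (q : ℝ) ≤ 1 := by exact_mod_cast hq1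
      rintro (⟨⟨h0, h0'⟩, h1, h2⟩ | ⟨⟨h0, h0'⟩, h1, h2⟩)
      · exact ⟨⟨h0, h0'.trans hq1'⟩, h1, h2⟩
      · exact ⟨⟨hq0'.trans h0, h0'⟩, h1, h2⟩
  · refine measure_mono_null (fun z hz => ?_) (volume_vline (q : ℝ))
    have h1 : z ∈ gband 0 q L U := hz.1
    have h2 : z ∈ gband q 1 L U := hz.2
    rw [mem_gband] at h1 h2; exact le_antisymm h1.1.2 h2.1.1

/-! ### A planar affine change of variables with rational coefficients (rule 2) -/

/-- **Affine substitution in the plane.**  `Φ(z) = M z + v` with `M ∈ GL₂(ℚ)`: if `Φ` maps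
`r.domain` onto `r'.domain` and `f = (f' ∘ Φ)·|det M|` on `r.domain`, then `[r] − [r'] ∈ KZ.relations`.
[cite: KontsevichZagier2001, §1.2 rule 2] -/
private theorem rel_affine (r r' : KZ.IntegralRep 2) (M : Matrix (Fin 2) (Fin 2) ℚ) (v : Fin 2 → ℚ)
    (Φ : (Fin 2 → ℝ) → (Fin 2 → ℝ))
    (hΦ : ∀ z i, Φ z i = (M i 0 : ℝ) * z 0 + (M i 1 : ℝ) * z 1 + (v i : ℝ))
    (hdet : M.det ≠ 0) (himg : r'.domain = Φ '' r.domain)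
    (hint : ∀ z ∈ r.domain, r.integrand z = r'.integrand (Φ z) * |(M.det : ℝ)|) :
    KZ.of r - KZ.of r' ∈ KZ.relations := by
  let Mr : Matrix (Fin 2) (Fin 2) ℝ := fun i j => (M i j : ℝ)
  let Lr : (Fin 2 → ℝ) →ₗ[ℝ] (Fin 2 → ℝ) := Matrix.toLin' Mr
  let Φ' : (Fin 2 → ℝ) → (Fin 2 → ℝ) →L[ℝ] (Fin 2 → ℝ) := fun _ => LinearMap.toContinuousLinearMap Lr
  have hLr : ∀ z, Lr z = fun i => (M i 0 : ℝ) * z 0 + (M i 1 : ℝ) * z 1 := by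
    intro z; funext i; simp [Lr, Mr, Matrix.toLin'_apply, Matrix.mulVec, dotProduct, Fin.sum_univ_two]
  have hΦL : Φ = fun z => Lr z + fun i => (v i : ℝ) := by
    funext z; funext i; rw [hΦ, Pi.add_apply, hLr]
  have hdetR : Mr.det = (M.det : ℝ) := by
    rw [Matrix.det_fin_two, Matrix.det_fin_two]; push_cast; simp [Mr]
  have hdet' : ∀ z, (Φ' z).det = (M.det : ℝ) := by
    intro z; rw [← hdetR]; unfold ContinuousLinearMap.det; simp [Φ', Lr, LinearMap.det_toLin']
  have hdetR' : ((M 0 0 * M 1 1 - M 0 1 * M 1 0 : ℚ) : ℝ) ≠ 0 := by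
    rw [← Matrix.det_fin_two]; exact_mod_cast hdet
  refine KZ.changeOfVariablesRel_subset_relations ⟨2, r, r', Φ, Φ', ?_, ?_, ?_, himg, ?_, rfl⟩
  · refine (isSemialgebraicMapOn_iff_forall_holds r.isSemialgebraic_domain).mpr fun i => ?_
    exact (isSemialgebraicFunOn_aeval r.isSemialgebraic_domain
      (C (M i 0) * X 0 + C (M i 1) * X 1 + C (v i))).congr fun z _ => by
        simp only [map_add, map_mul, aeval_C, aeval_X, eq_ratCast, hΦ]
  · intro z _
    rw [hΦL]; have h := ((LinearMap.toContinuousLinearMap Lr).hasFDerivAt (x := z)).add_const (fun i => (v i : ℝ))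
    simpa [Φ'] using h.hasFDerivWithinAt
  · intro z₁ _ z₂ _ h
    have e1 := congrFun h 0; have e2 := congrFun h 1; simp only [hΦ] at e1 e2
    have hx : ((M 0 0 * M 1 1 - M 0 1 * M 1 0 : ℚ) : ℝ) * (z₁ 0 - z₂ 0) = 0 := by
      push_cast; linear_combination (M 1 1 : ℝ) * e1 - (M 0 1 : ℝ) * e2
    have hy : ((M 0 0 * M 1 1 - M 0 1 * M 1 0 : ℚ) : ℝ) * (z₁ 1 - z₂ 1) = 0 := by
      push_cast; linear_combination (M 0 0 : ℝ) * e2 - (M 1 0 : ℝ) * e1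
    rcases mul_eq_zero.1 hx with h1 | h1
    · exact absurd h1 hdetR'
    rcases mul_eq_zero.1 hy with h2 | h2
    · exact absurd h2 hdetR'
    funext i; fin_cases i
    · exact sub_eq_zero.1 h1
    · exact sub_eq_zero.1 h2
  · intro z hz
    rw [hint z hz, hdet' z]

/-! ### The pieces and the four affine maps -/

/-- Auxiliary definition `QA` (§8): QA. [bookkeeping] -/
def QA : MvPolynomial (Fin 2) ℚ := 2 - X 0 + X 1 + X 0 ^ 2 - X 1 ^ 2
/-- Auxiliary definition `PH` (§8): PH. [bookkeeping] -/
def PH (c : ℚ) : MvPolynomial (Fin 2) ℚ := 4 + 2 * C c * X 0 * X 1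

/-- Auxiliary step `QA_pos` (§8): QA pos. [bookkeeping] -/
theorem QA_pos {x : Fin 2 → ℝ} (hx : x ∈ cube 2) : 0 < aeval x QA := by
  have h0 := (hx 0).1; have h0' := (hx 0).2; have h1 := (hx 1).1; have h1' := (hx 1).2
  simp only [QA, map_add, map_sub, map_pow, map_ofNat, aeval_X]; nlinarith [sq_nonneg (x 0 - 1 / 2), mul_nonneg h1 (sub_nonneg.2 h1')]

/-- Auxiliary step `PH_ge` (§8): PH ge. [bookkeeping] -/
theorem PH_ge {c : ℚ} (hc : -1 ≤ c ∧ c ≤ 1) {z : Fin 2 → ℝ} (hz : z ∈ sbDom zeroE omE) :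
    (7 / 2 : ℝ) ≤ aeval z (PH c) := by
  have h := PΔ_ge hc hz
  simp only [PΔ, map_add, map_mul, map_one, aeval_C, aeval_X, eq_ratCast] at h; simp only [PH, map_add, map_mul, map_ofNat, aeval_C, aeval_X, eq_ratCast]; linarith

/-- Census row #18, A-side: `A18 = [□², dx dy/(2 − x + y + x² − y²)]`; the quarter-integrand
triangle forms `H(c) = [Δ, 1/(4 + 2c·w·v)]` (proof text = `GoldenPair10.lean` §8 with `κ = 2`). -/
def A18 : RFun 2 := ⟨1, QA, fun _ hx => (QA_pos hx).ne'⟩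
/-- Auxiliary definition `H` (§8): H. [bookkeeping] -/
def H (c : ℚ) (hc : -1 ≤ c ∧ c ≤ 1) : KZ.IntegralRep 2 :=
  BRq zeroE omE 1 (PH c) (7 / 2) 1 (by norm_num) (fun _ hz => PH_ge hc hz) fun z _ => abs_aeval_one_le z

/-- Auxiliary step `hA18` (§8): h A18. [bookkeeping] -/
theorem hA18 : A18.rep.domain = sbDom zeroE oneE := by rw [RFun.rep_domain, cube_eq_sbDom]
/-- Auxiliary step `zero_le_mn` (§8): zero le mn. [bookkeeping] -/
theorem zero_le_mn : ∀ t ∈ Icc (0 : ℝ) 1, zeroE.f t ≤ mnE.f t := fun t ht => by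
  simp only [zeroE_f, mnE_f]; exact le_min ht.1 (by linarith [ht.2])
/-- Auxiliary step `mn_le_one` (§8): mn le one. [bookkeeping] -/
theorem mn_le_one : ∀ t ∈ Icc (0 : ℝ) 1, mnE.f t ≤ oneE.f t := fun t ht => by
  simp only [oneE_f, mnE_f]; exact min_le_of_left_le ht.2
/-- Auxiliary step `mn_le_mx` (§8): mn le mx. [bookkeeping] -/
theorem mn_le_mx : ∀ t ∈ Icc (0 : ℝ) 1, mnE.f t ≤ mxE.f t := fun t _ => by
  simp only [mnE_f, mxE_f]; exact min_le_max
/-- Auxiliary step `mx_le_one` (§8): mx le one. [bookkeeping] -/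
theorem mx_le_one : ∀ t ∈ Icc (0 : ℝ) 1, mxE.f t ≤ oneE.f t := fun t ht => by
  simp only [oneE_f, mxE_f]; exact max_le ht.2 (by linarith [ht.1])

/-- The pieces: `Bot` (below both diagonals), `Rest`, `Mid = Left ∪ Right`, `Top`, `MidL`, `MidR`. -/
def Bot : KZ.IntegralRep 2 := loP A18.rep zeroE mnE oneE hA18 mn_le_one
/-- Auxiliary definition `Rest` (§8): Rest. [bookkeeping] -/
def Rest : KZ.IntegralRep 2 := hiP A18.rep zeroE mnE oneE hA18 zero_le_mn
/-- Auxiliary definition `Mid` (§8): Mid. [bookkeeping] -/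
def Mid : KZ.IntegralRep 2 := loP Rest mnE mxE oneE rfl mx_le_one
/-- Auxiliary definition `Top` (§8): Top. [bookkeeping] -/
def Top : KZ.IntegralRep 2 := hiP Rest mnE mxE oneE rfl mn_le_mx
/-- Auxiliary definition `MidL` (§8): Mid L. [bookkeeping] -/
def MidL : KZ.IntegralRep 2 := GB Mid mnE mxE rfl 0 (1 / 2) le_rfl (by norm_num)
/-- Auxiliary definition `MidR` (§8): Mid R. [bookkeeping] -/
def MidR : KZ.IntegralRep 2 := GB Mid mnE mxE rfl (1 / 2) 1 (by norm_num) le_rfl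

/-- Auxiliary step `d1` (§8): d1. [bookkeeping] -/
theorem d1 : KZ.of A18.rep - KZ.of Bot - KZ.of Rest ∈ KZ.relations :=
  br_cut A18.rep zeroE mnE oneE hA18 zero_le_mn mn_le_one
/-- Auxiliary step `d2` (§8): d2. [bookkeeping] -/
theorem d2 : KZ.of Rest - KZ.of Mid - KZ.of Top ∈ KZ.relations :=
  br_cut Rest mnE mxE oneE rfl mn_le_mx mx_le_one
/-- Auxiliary step `d3` (§8): d3. [bookkeeping] -/
theorem d3 : KZ.of Mid - KZ.of MidL - KZ.of MidR ∈ KZ.relations :=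
  gcut Mid mnE mxE rfl (1 / 2) (by norm_num) (by norm_num)

/-- The integrand identity behind all four maps: `Q_A18 = 2 + (x − y)(x + y − 1)`. -/
theorem A18_integrand (z : Fin 2 → ℝ) : A18.rep.integrand z =
    1 / (2 + (z 0 - z 1) * (z 0 + z 1 - 1)) := by
  rw [RFun.rep_integrand]; simp only [RFun.fn, A18, QA, map_add, map_sub, map_pow, map_ofNat, map_one, aeval_X]; congr 1; ring

/-- Auxiliary step `A18_den_pos` (§8): A18 den pos. [bookkeeping] -/
theorem A18_den_pos {z : Fin 2 → ℝ} (hz : z ∈ cube 2) : 0 < 2 + (z 0 - z 1) * (z 0 + z 1 - 1) := by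
  have h := QA_pos hz; simp only [QA, map_add, map_sub, map_pow, map_ofNat, aeval_X] at h; nlinarith [h]

/-- Auxiliary step `H_integrand` (§8): H integrand. [bookkeeping] -/
theorem H_integrand (c : ℚ) (hc : -1 ≤ c ∧ c ≤ 1) (w : Fin 2 → ℝ) :
    (H c hc).integrand w = 1 / (4 + 2 * (c : ℝ) * w 0 * w 1) := by
  simp only [H, BRq_integrand, PH, map_add, map_mul, map_ofNat, map_one, aeval_C, aeval_X, eq_ratCast]

/-- Auxiliary step `mem_H_domain` (§8): mem H domain. [bookkeeping] -/
theorem mem_H_domain {c : ℚ} {hc : -1 ≤ c ∧ c ≤ 1} {w : Fin 2 → ℝ} :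
    w ∈ (H c hc).domain ↔ (0 ≤ w 0 ∧ w 0 ≤ 1) ∧ 0 ≤ w 1 ∧ w 1 ≤ 1 - w 0 := by
  show w ∈ sbDom zeroE omE ↔ _; rw [mem_sbDom, zeroE_f, omE_f]

/-- The final arithmetic of each map: `1/A = (1/B)·2` when `B = 2A`. -/
theorem inv_eq_inv_mul_two {A B : ℝ} (hA : 0 < A) (hB : B = 2 * A) : 1 / A = 1 / B * 2 := by
  rw [hB]; field_simp

end Summit.KontsevichZagierPeriods.RootDecompQuadraticDescent.Pair18
end
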